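import Summits.HodgeConjecture.HodgeConjecture.Theorems.R90S3PlantedPolynomial              -- ★ P3b: `exists_plantedPolynomial`, `map_eq_of_coeff_eq`, `intCast_eq_castHom_of_dvd`
import Summits.HodgeConjecture.HodgeConjecture.Theorems.R90S3IrreduciblePrescribedConstant   -- ★ P4′: ℓ-targets, two-prime sieve
import Summits.HodgeConjecture.HodgeConjecture.Theorems.R90S3PlantingTargetList             -- ★ B4b-inst (this seat): `exists_monic_no_root_coeff_zero_eq_zmod_of_two_le`
import Mathlib.Data.Nat.ChineseRemainder
import HarnessLib

/-!
# R90-TF · S3 · THEOREMS — `R90S3PlantingTargetListTwo` ((U3-F) split, p = 2 pass, brick C1 = TargetList₂): the planted `g ∈ ℤ[X]` hitting the THREE targets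
# `{2^N, ℓ₁, ℓ₂}` — `g ≡ T₂ (mod 2^N)`, irreducible over `ℚ`, constant term `c₀` exact, all roots real and negative

R90-TF section S3 (dealer R90-C12-plan (g3), deal S3-p21″ 2026-09-05T01:41:26Z; census memo `R90/S3/CENSUS-U3F-p2.K2E3-p21-g9.md` (01:43Z) brick C1); crux H413
(`stmt-HodgeConjecture-24833`, lane `--supports … --as helper`), route `HCCMUnconditional`.  The `p = 2` twin of ★ `R90S3PlantingTargetList`: when the planted prime is `2`
the local target `H ∈ ℤ₂[X]` (★ `R90S3LocalPlantingDatumTwo` ∕ `R90S3LocalTargetTwo`) IS the dyadic target, so the moduli are `{2^N, ℓ₁, ℓ₂}` (three, not four) and the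
separate dyadic base `b`, the parity constraint C1 and `hbc` disappear.  The `2`-adic target enters as an ABSTRACT monic `T₂ ∈ (ℤ∕2^N)[X]` with `T₂(0) = c₀` (the captain
instantiates `T₂ := H.map (PadicInt.toZModPow N)`, `c₀ := 2^a`, via ★ `map_toZModPow_target`); `N` and `T₂` are universally bound, so there is no ∃∕∀ circularity.
THEOREMS ONLY (no `def`, no `instance`, no notation, no named fact, no `sorry`); ★∕Mathlib imports only; never imports `Cruxes/…/Lines`.

THE MATHEMATICS [Neukirch1999 Ch. I §3 (3.6); LidlNiederreiter1997 Ch. 3 §§1–2].  §1 = ★ B4a for THREE explicit pairwise-coprime moduli (nested `Nat.chineseRemainder`,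
★ P3b planting, read back by ★ `map_eq_of_coeff_eq`).  §2: `m = (2^N, ℓ₁, ℓ₂)` for odd primes `ℓ₁ ≠ ℓ₂`; `T₀ = T₂`; `T₁ = (X + t)·h`, `h` irreducible of degree `d − 1` (★ P4′);
`T₂′` without roots mod `ℓ₂` (★ `exists_monic_no_root_coeff_zero_eq_zmod_of_two_le`, `ℓ₂ ∤ c₀`); ★ P4′'s two-prime sieve ⇒ `g` irreducible over `ℚ`.
* §1 `exists_nat_modEq_three`, **`exists_planted_of_three_targets`**; §2 **`exists_planted_targetList_two`**.

HONEST LABEL: HC_CM is proved only modulo the 7 printed citations (2 remaining named inputs: hLiu418 = stmt-HodgeConjecture-24832, h413 =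
stmt-HodgeConjecture-24833) until rung 0 closes; glue toward the GENUINE residual (U3-F), p = 2 branch; proves nothing printed; count-neutral.

## References
* [Neukirch1999] J. Neukirch, *Algebraic Number Theory* (1999), Ch. I §3 (3.6).
* [LidlNiederreiter1997] R. Lidl, H. Niederreiter, *Finite Fields*, 2nd ed. (1997), Ch. 3 §§1–2.
-/

set_option autoImplicit false
-- the mandated namespace repeats the single-problem summit's segment (`HodgeConjecture.HodgeConjecture`)
set_option linter.dupNamespace false

noncomputable section

namespace Summit.HodgeConjecture.HodgeConjecture.R90.S3

open Polynomial

/-! ## §1 ★ B4a for three explicit moduli (non-dependent form) -/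

/-- **CRT for three pairwise-coprime moduli** (nested Mathlib `Nat.chineseRemainder`). [cite: Neukirch1999, Ch. I §3 (3.6)] -/
theorem exists_nat_modEq_three (m₀ m₁ m₂ : ℕ) (h01 : m₀.Coprime m₁) (h02 : m₀.Coprime m₂) (h12 : m₁.Coprime m₂) (a₀ a₁ a₂ : ℕ) :
    ∃ n : ℕ, n ≡ a₀ [MOD m₀] ∧ n ≡ a₁ [MOD m₁] ∧ n ≡ a₂ [MOD m₂] := by
  obtain ⟨k₁, hk₁0, hk₁1⟩ := Nat.chineseRemainder h01 a₀ a₁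
  have h012 : (m₀ * m₁).Coprime m₂ := Nat.Coprime.mul_left h02 h12
  obtain ⟨k₂, hk₂01, hk₂2⟩ := Nat.chineseRemainder h012 k₁ a₂
  exact ⟨k₂, (hk₂01.of_dvd (dvd_mul_right m₀ m₁)).trans hk₁0, (hk₂01.of_dvd (dvd_mul_left m₁ m₀)).trans hk₁1, hk₂2⟩

/-- **★ B4a FOR THREE TARGETS** (non-dependent form).  Monic targets `Tⱼ ∈ (ℤ∕mⱼ)[X]` of degree `d ≥ 2` modulo pairwise-coprime non-zero `m₀, m₁, m₂`, all with
constant term `c₀ > 0`: a monic `g ∈ ℤ[X]` of degree `d` with `g(0) = c₀` EXACTLY, `g mod mⱼ = Tⱼ`, `d` distinct real roots, all negative, every complex root a negative real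
(★ P3b at `Q = m₀ m₁ m₂`). [cite: Neukirch1999, Ch. I §3 (3.6)] -/
theorem exists_planted_of_three_targets {d : ℕ} (hd : 2 ≤ d) (m₀ m₁ m₂ : ℕ) (hm₀ : m₀ ≠ 0) (hm₁ : m₁ ≠ 0) (hm₂ : m₂ ≠ 0)
    (h01 : m₀.Coprime m₁) (h02 : m₀.Coprime m₂) (h12 : m₁.Coprime m₂)
    (T₀ : (ZMod m₀)[X]) (T₁ : (ZMod m₁)[X]) (T₂ : (ZMod m₂)[X])
    (hT₀ : T₀.Monic ∧ T₀.natDegree = d) (hT₁ : T₁.Monic ∧ T₁.natDegree = d) (hT₂ : T₂.Monic ∧ T₂.natDegree = d)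
    (c₀ : ℤ) (hc₀ : 0 < c₀) (h₀0 : T₀.coeff 0 = c₀) (h₁0 : T₁.coeff 0 = c₀) (h₂0 : T₂.coeff 0 = c₀) :
    ∃ g : ℤ[X], g.Monic ∧ g.natDegree = d ∧ g.coeff 0 = c₀ ∧
      g.map (Int.castRingHom (ZMod m₀)) = T₀ ∧ g.map (Int.castRingHom (ZMod m₁)) = T₁ ∧ g.map (Int.castRingHom (ZMod m₂)) = T₂ ∧
      (g.map (Int.castRingHom ℝ)).roots.toFinset.card = d ∧ (∀ x ∈ (g.map (Int.castRingHom ℝ)).roots, x < 0) ∧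
        ∀ z : ℂ, (g.map (Int.castRingHom ℂ)).IsRoot z → z.im = 0 ∧ z.re < 0 := by
  haveI : NeZero m₀ := ⟨hm₀⟩; haveI : NeZero m₁ := ⟨hm₁⟩; haveI : NeZero m₂ := ⟨hm₂⟩
  set Q : ℕ := m₀ * m₁ * m₂ with hQ
  haveI : NeZero Q := ⟨by rw [hQ]; exact mul_ne_zero (mul_ne_zero hm₀ hm₁) hm₂⟩
  have hd₀ : m₀ ∣ Q := ⟨m₁ * m₂, by rw [hQ]; ring⟩
  have hd₁ : m₁ ∣ Q := ⟨m₀ * m₂, by rw [hQ]; ring⟩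
  have hd₂ : m₂ ∣ Q := ⟨m₀ * m₁, by rw [hQ]; ring⟩
  -- coefficientwise CRT residues
  choose n hn using fun k : ℕ => exists_nat_modEq_three m₀ m₁ m₂ h01 h02 h12 (T₀.coeff k).val (T₁.coeff k).val (T₂.coeff k).val
  obtain ⟨g, hgm, hgd, hg0, hmid, hcard, hneg, hcx⟩ := exists_plantedPolynomial hd Q (fun k => (n k : ZMod Q)) c₀ hc₀
  -- reading a residue class back modulo `mⱼ`
  have hread : ∀ {m : ℕ} [NeZero m] (hm : m ∣ Q) (T : (ZMod m)[X]) (k : ℕ), n k ≡ (T.coeff k).val [MOD m] → 0 < k → k < d →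
      ((g.coeff k : ℤ) : ZMod m) = T.coeff k := fun hm T k hk hk0 hkd => by
    rw [intCast_eq_castHom_of_dvd hm (hmid k hk0 hkd), map_natCast, (ZMod.natCast_eq_natCast_iff _ _ _).2 hk, ZMod.natCast_zmod_val]
  refine ⟨g, hgm, hgd, hg0, ?_, ?_, ?_, hcard, hneg, hcx⟩
  · exact map_eq_of_coeff_eq hgm hgd T₀ hT₀.1 hT₀.2 (by rw [hg0, h₀0]) fun k hk hkd => hread hd₀ T₀ k (hn k).1 hk hkd
  · exact map_eq_of_coeff_eq hgm hgd T₁ hT₁.1 hT₁.2 (by rw [hg0, h₁0]) fun k hk hkd => hread hd₁ T₁ k (hn k).2.1 hk hkd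
  · exact map_eq_of_coeff_eq hgm hgd T₂ hT₂.1 hT₂.2 (by rw [hg0, h₂0]) fun k hk hkd => hread hd₂ T₂ k (hn k).2.2 hk hkd

/-! ## §2 The instantiated list `{2^N, ℓ₁, ℓ₂}` (planted prime `2`) -/

/-- **TargetList₂ — THE PLANTED POLYNOMIAL HITTING `{2^N, ℓ₁, ℓ₂}` (planted prime `2`).**  For odd primes `ℓ₁ ≠ ℓ₂`, any exponent `N`, a degree `d ≥ 2` (`gcd(3, ℓ₂ − 1) = 1`
if `d = 3`), a constant `c₀ > 0` prime to `ℓ₂`, and a monic `2`-adic target `T₂ ∈ (ℤ∕2^N)[X]` of degree `d` with `T₂(0) = c₀`: a monic `g ∈ ℤ[X]` of degree `d` with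
`g(0) = c₀`, `g ≡ T₂ (mod 2^N)`, `g` IRREDUCIBLE over `ℚ` (★ P4′ two-prime sieve at `ℓ₁, ℓ₂`), `d` distinct real roots, all negative, every complex root a negative real.
[cite: Neukirch1999, Ch. I §3 (3.6)] [cite: LidlNiederreiter1997, Ch. 3 §§1–2] -/
theorem exists_planted_targetList_two {d : ℕ} (hd : 2 ≤ d) (ℓ₁ ℓ₂ : ℕ) [hℓ₁ : Fact ℓ₁.Prime] [hℓ₂ : Fact ℓ₂.Prime]
    (hℓ₁2 : ℓ₁ ≠ 2) (hℓ₂2 : ℓ₂ ≠ 2) (hℓ : ℓ₁ ≠ ℓ₂) (N : ℕ) (c₀ : ℤ) (hc₀ : 0 < c₀) (hc₀ℓ₂ : ¬ (ℓ₂ : ℤ) ∣ c₀)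
    (hd3 : d = 3 → Nat.Coprime 3 (ℓ₂ - 1)) (T₂ : (ZMod (2 ^ N))[X]) (hTm : T₂.Monic) (hTd : T₂.natDegree = d) (hT0 : T₂.coeff 0 = c₀) :
    ∃ g : ℤ[X], g.Monic ∧ g.natDegree = d ∧ g.coeff 0 = c₀ ∧ g.map (Int.castRingHom (ZMod (2 ^ N))) = T₂ ∧
      Irreducible (g.map (Int.castRingHom ℚ)) ∧
      (g.map (Int.castRingHom ℝ)).roots.toFinset.card = d ∧ (∀ x ∈ (g.map (Int.castRingHom ℝ)).roots, x < 0) ∧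
        ∀ z : ℂ, (g.map (Int.castRingHom ℂ)).IsRoot z → z.im = 0 ∧ z.re < 0 := by
  -- the moduli are pairwise coprime and non-zero
  have hc2ℓ₁ : (2 : ℕ).Coprime ℓ₁ := (Nat.coprime_primes Nat.prime_two hℓ₁.out).2 (Ne.symm hℓ₁2)
  have hc2ℓ₂ : (2 : ℕ).Coprime ℓ₂ := (Nat.coprime_primes Nat.prime_two hℓ₂.out).2 (Ne.symm hℓ₂2)
  have hcℓ : ℓ₁.Coprime ℓ₂ := (Nat.coprime_primes hℓ₁.out hℓ₂.out).2 hℓ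
  -- the `ℓ₁`-target `(X + t) · h`, `h` irreducible of degree `d − 1`
  obtain ⟨t, h, -, hirr, -, -, hlm, hld, hl0⟩ := exists_linear_mul_irreducible_coeff_zero_eq (k := ZMod ℓ₁) hd ((c₀ : ℤ) : ZMod ℓ₁)
  -- the `ℓ₂`-target without roots
  have hcne : ((c₀ : ℤ) : ZMod ℓ₂) ≠ 0 := fun h0 => hc₀ℓ₂ ((ZMod.intCast_zmod_eq_zero_iff_dvd c₀ ℓ₂).1 h0)
  obtain ⟨T₃, hT₃m, hT₃d, hT₃0, hT₃nr⟩ := exists_monic_no_root_coeff_zero_eq_zmod_of_two_le ℓ₂ hd hd3 hcne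
  -- plant
  obtain ⟨g, hgm, hgd, hg0, hg₀, hg₁, hg₂, hcard, hneg, hcx⟩ := exists_planted_of_three_targets hd (2 ^ N) ℓ₁ ℓ₂
    (pow_ne_zero N two_ne_zero) hℓ₁.out.ne_zero hℓ₂.out.ne_zero
    (Nat.Coprime.pow_left N hc2ℓ₁) (Nat.Coprime.pow_left N hc2ℓ₂) hcℓ
    T₂ ((X + C t) * h) T₃ ⟨hTm, hTd⟩ ⟨hlm, hld⟩ ⟨hT₃m, hT₃d⟩ c₀ hc₀ hT0 hl0 hT₃0
  -- irreducibility over `ℚ` by the two-prime sieve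
  have hirrQ : Irreducible (g.map (Int.castRingHom ℚ)) :=
    irreducible_map_rat_of_map_eq_linear_mul_irreducible_of_forall_not_isRoot hgm hgd hd (X + C t) h (monic_X_add_C t) (natDegree_X_add_C t) hirr hg₁
      (fun x => by rw [hg₂]; exact hT₃nr x)
  exact ⟨g, hgm, hgd, hg0, hg₀, hirrQ, hcard, hneg, hcx⟩

end Summit.HodgeConjecture.HodgeConjecture.R90.S3

end
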